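import Literature.Analysis.FluidPDE.LocalPressureSliceRepresentation
import Literature.Analysis.FluidPDE.ApexPackageShellPressure
import HarnessLib

/-!
# The gauge-free `L¹` budget of the pressure on a quiet shell, on one time slice
# (Kang–Miura–Tsai 2021 Lemma 3.4 ⇒ shell bound)

Analysis/FluidPDE support file (theorems only, everything PROVED; no definitions, no named facts,
no `sorry`): the assembly of

* the local pressure expansion on a slice, `p = p̃[1_{B_{2r}} w] + p_far + κ` a.e. on `B_r`
  (`slice_pressure_representation`, `LocalPressureSliceRepresentation.lean`; Kang–Miura–Tsai,
  IMRN 2021 = arXiv:1812.10509, **Lemma 3.4**, proof §8; the constant `κ = c_{x₀,r}(t)` of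
  PAA 2021 = arXiv:2006.13145 Def. 2.1 (iv)), which holds under the slice identities
  `∫ [p ∂ₑλ_δ(c − ·) + D³Φ_δ(c − ·)(e)(w, w)] = 0` (all `δ = 1/(n+1)`, `c`, `e`),
* the shell law for the near field when `|w| ≤ K` on an annulus `S = {R₁ < |y| < R₂} ⊆ B_{2r}`
  (`QuietShellPressure.exists_lintegral_subshell_normalisedPressure_near_le`,
  `ApexPackageShellPressure.lean`; Bronzi–Shvydkoy 2015 §2 Lemma 2.1 Step 2), and
* the far-field bound at scale `r` by the uniformly local energy
  (`QuietShellPressure.exists_enorm_localPressureFar_le_of_uloc_scale`; KMT §8),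

into ONE statement, `QuietShellPressure.exists_subshell_pressure_budget`: for every `r > 0` there are
finite constants `C, F` such that every slice `(w, p)` with the slice identities, uniformly local
energy (`A` at unit scale, `α` at scale `r`), `∫_{B_{2r}} |w|³ < ∞`, `p ∈ L¹_loc` and `|w| ≤ K` a.e.
on `S` admits a constant `κ` with
`∫_{ρ₁<|y|<ρ₂} |p − κ| ≤ C K² |S| + ((2πθ³)⁻¹ ∫_{B_{2r}} |w|² + F α) |S|`
for every sub-shell `R₁ + θ ≤ ρ₁`, `ρ₂ ≤ R₂ − θ`, `ρ₂ ≤ r` — the constants depend on `r` only, so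
the budget is UNIFORM in time as soon as `K`, `α` and `∫_{B_{2r}}|w|²` are (the form consumed by
the terminal-trace route of the Navier–Stokes summit: a gauge-free shell budget `∫_K |q(t) − c| ≤ m_P`).

## Mathlib / tree search

Reused by name: `slice_pressure_representation`, `localPressureFar`, `normalisedPressure`,
`QuietShellPressure.exists_lintegral_subshell_normalisedPressure_near_le`,
`QuietShellPressure.exists_enorm_localPressureFar_le_of_uloc_scale`.  Mathlib:
`ae_restrict_of_ae_restrict_of_subset`, `lintegral_congr_ae`, `lintegral_add_left'`,
`setLIntegral_mono'`, `lintegral_mono_set`.  `lean search 'shell.*budget|subshell_pressure'`: nothing.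
No new definitions, no instances, no notation.
-/

noncomputable section

-- nested operator types `ℝ³ →L[ℝ] ℝ³ →L[ℝ] ℝ³ →L[ℝ] ℝ`
set_option maxSynthPendingDepth 3

open MeasureTheory Set Filter Topology Metric
open scoped ENNReal NNReal RealInnerProductSpace Laplacian

namespace Literature.Analysis.FluidPDE

namespace QuietShellPressure

/-- The annulus `{a < |z| < b}` is measurable. [folklore] -/
private theorem measurableSet_annulus' (a b : ℝ) :
    MeasurableSet {z : EuclideanSpace ℝ (Fin 3) | a < ‖z‖ ∧ ‖z‖ < b} :=
  (isOpen_lt continuous_const continuous_norm).measurableSet.inter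
    (isOpen_lt continuous_norm continuous_const).measurableSet

/-- **The gauge-free `L¹` budget of the pressure on a quiet shell (one slice).** For every `r > 0`
there are finite constants `C, F` (depending only on `r`; `C` is Stein's `L⁴ × L⁴ → L²` constant)
such that: for every a.e.-strongly measurable `w : ℝ³ → ℝ³` with uniformly local energy `A < ∞` at
unit scale and `α` at scale `r`, `∫_{B_{2r}(0)} |w|³ < ∞`, every `p ∈ L¹_loc(ℝ³)` satisfying with `w`
the slice identities `∫ [p ∂ₑλ_δ(c − ·) + D³Φ_δ(c − ·)(e)(w, w)] = 0` (`δ = 1/(n+1)`, all `c, e`),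
and every annulus `S = {R₁ < |z| < R₂}`, `R₂ ≤ 2r`, on which `|w| ≤ K` a.e., there is a constant
`κ` (the `c_{0,r}` of the local pressure expansion) with, for every sub-shell
`T = {ρ₁ < |y| < ρ₂}`, `R₁ + θ ≤ ρ₁`, `ρ₂ ≤ R₂ − θ`, `ρ₂ ≤ r`, `θ > 0`:
`∫_T |p − κ| ≤ C K² |S| + ((2πθ³)⁻¹ ∫_{B_{2r}} |w|² + F α) |S|`
(`p − κ = p̃[1_{B_{2r}} w] + p_far` a.e. on `B_r ⊇ T`; the near field by the shell law, the far
field pointwise). [cite: KangMiuraTsai2020, Lemma 3.4 (pressure decomposition `π = π_loc + π_far + c_{x₀,r}(t)`), arXiv:1812.10509 p. 8, proof §8 pp. 17–18] [cite: BronziShvydkoy2015, §2 Lemma 2.1, Step 2 and eq. (2.4) (the shell estimate of the near field)] -/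
theorem exists_subshell_pressure_budget {r : ℝ} (hr : 0 < r) :
    ∃ C F : ℝ≥0∞, C ≠ ⊤ ∧ F ≠ ⊤ ∧
      ∀ (w : EuclideanSpace ℝ (Fin 3) → EuclideanSpace ℝ (Fin 3)) (p : EuclideanSpace ℝ (Fin 3) → ℝ)
        (A α : ℝ≥0∞) (R₁ R₂ K : ℝ),
        AEStronglyMeasurable w volume → A ≠ ⊤ →
        (∀ z : EuclideanSpace ℝ (Fin 3), ∫⁻ y in ball z 1, ‖w y‖ₑ ^ 2 ≤ A) →
        (∀ z : EuclideanSpace ℝ (Fin 3), ∫⁻ y in ball z r, ‖w y‖ₑ ^ 2 ≤ α) →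
        ∫⁻ y in ball (0 : EuclideanSpace ℝ (Fin 3)) (2 * r), ‖w y‖ₑ ^ (3 : ℕ) ≠ ⊤ →
        LocallyIntegrable p volume →
        (∀ (n : ℕ) (c e : EuclideanSpace ℝ (Fin 3)),
          ∫ x, (p x * fderiv ℝ (Δ (newtonReg ((n : ℝ) + 1)⁻¹)) (c - x) e +
            evalDiag (w x)
              (fderiv ℝ (fderiv ℝ (fderiv ℝ (newtonReg ((n : ℝ) + 1)⁻¹))) (c - x) e)) = 0) →
        R₂ ≤ 2 * r →
        (∀ᵐ z ∂volume, R₁ < ‖z‖ → ‖z‖ < R₂ → ‖w z‖ ≤ K) →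
        ∃ κ : ℝ, ∀ (θ ρ₁ ρ₂ : ℝ), 0 < θ → R₁ + θ ≤ ρ₁ → ρ₂ ≤ R₂ - θ → ρ₂ ≤ r →
          ∫⁻ y in {y : EuclideanSpace ℝ (Fin 3) | ρ₁ < ‖y‖ ∧ ‖y‖ < ρ₂}, ‖p y - κ‖ₑ ≤
            C * ENNReal.ofReal K ^ 2 * volume {z : EuclideanSpace ℝ (Fin 3) | R₁ < ‖z‖ ∧ ‖z‖ < R₂} +
              (ENNReal.ofReal ((2 * Real.pi * θ ^ 3)⁻¹) *
                  (∫⁻ z in ball (0 : EuclideanSpace ℝ (Fin 3)) (2 * r), ‖w z‖ₑ ^ 2) + F * α) *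
                volume {z : EuclideanSpace ℝ (Fin 3) | R₁ < ‖z‖ ∧ ‖z‖ < R₂} := by
  obtain ⟨C, hC⟩ := exists_lintegral_subshell_normalisedPressure_near_le
  obtain ⟨F, hFtop, hF⟩ := exists_enorm_localPressureFar_le_of_uloc_scale hr
  refine ⟨(C : ℝ≥0∞), F, ENNReal.coe_ne_top, hFtop, ?_⟩
  intro w p A α R₁ R₂ K hw hAtop hA hα hI3 hp hid hR₂ hK
  -- the local pressure expansion on the slice, centred at the origin
  obtain ⟨κ, -, hrepr⟩ := slice_pressure_representation hw hAtop hA hp hid 0 hr hI3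
  refine ⟨κ, fun θ ρ₁ ρ₂ hθ hρ₁ hρ₂ hρ₂r => ?_⟩
  set S : Set (EuclideanSpace ℝ (Fin 3)) := {z | R₁ < ‖z‖ ∧ ‖z‖ < R₂} with hS
  set T : Set (EuclideanSpace ℝ (Fin 3)) := {y | R₁ + θ < ‖y‖ ∧ ‖y‖ < R₂ - θ} with hT
  set T' : Set (EuclideanSpace ℝ (Fin 3)) := {y | ρ₁ < ‖y‖ ∧ ‖y‖ < ρ₂} with hT'
  have hT'm : MeasurableSet T' := measurableSet_annulus' ρ₁ ρ₂
  have hT'T : T' ⊆ T := fun y hy => ⟨lt_of_le_of_lt hρ₁ hy.1, lt_of_lt_of_le hy.2 hρ₂⟩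
  have hTS : T ⊆ S := fun y hy => ⟨by linarith [hy.1, hθ], by linarith [hy.2, hθ]⟩
  have hT'B : T' ⊆ ball (0 : EuclideanSpace ℝ (Fin 3)) r := fun y hy => by
    rw [mem_ball_zero_iff]; exact lt_of_lt_of_le hy.2 hρ₂r
  set near : EuclideanSpace ℝ (Fin 3) → ℝ :=
    normalisedPressure ((ball (0 : EuclideanSpace ℝ (Fin 3)) (2 * r)).indicator w) with hnear
  set far : EuclideanSpace ℝ (Fin 3) → ℝ := localPressureFar 0 r (fun _ => w) 0 with hfar
  -- `p - κ = near + far` a.e. on `T'`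
  have hae : ∀ᵐ y ∂(volume.restrict T'), ‖p y - κ‖ₑ = ‖near y + far y‖ₑ := by
    filter_upwards [ae_restrict_of_ae_restrict_of_subset hT'B hrepr] with y hy
    rw [hy]
    congr 1
    ring
  rw [lintegral_congr_ae hae]
  -- the far field pointwise on `T' ⊆ B_r`
  have hfarpt : ∀ y ∈ T', ‖far y‖ₑ ≤ F * α := fun y hy =>
    hF (v := fun _ => w) (t := (0 : ℝ)) (x₀ := 0) hw hα y (hT'B hy)
  -- the near field by the shell law
  have hnearT := hC w R₁ R₂ θ (2 * r) K hw hθ hR₂ hK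
  set cθ : ℝ≥0∞ := ENNReal.ofReal ((2 * Real.pi * θ ^ 3)⁻¹) *
    ∫⁻ z in ball (0 : EuclideanSpace ℝ (Fin 3)) (2 * r), ‖w z‖ₑ ^ 2 with hcθ
  calc ∫⁻ y in T', ‖near y + far y‖ₑ
      ≤ ∫⁻ y in T', (‖near y‖ₑ + F * α) := by
        refine setLIntegral_mono' hT'm fun y hy => (enorm_add_le _ _).trans ?_
        exact add_le_add le_rfl (hfarpt y hy)
    _ = (∫⁻ y in T', ‖near y‖ₑ) + F * α * volume T' := by
        rw [lintegral_add_right _ measurable_const, lintegral_const, Measure.restrict_apply_univ]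
    _ ≤ (∫⁻ y in T, ‖near y‖ₑ) + F * α * volume S :=
        add_le_add (lintegral_mono_set hT'T) (mul_le_mul' le_rfl (measure_mono (hT'T.trans hTS)))
    _ ≤ (C * ENNReal.ofReal K ^ 2 * volume S + cθ * volume T) + F * α * volume S :=
        add_le_add hnearT le_rfl
    _ ≤ (C * ENNReal.ofReal K ^ 2 * volume S + cθ * volume S) + F * α * volume S := by
        gcongr
    _ = C * ENNReal.ofReal K ^ 2 * volume S + (cθ + F * α) * volume S := by ring

end QuietShellPressure

end Literature.Analysis.FluidPDE

end
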